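import Mathlib

/-!
# Stub `stub_separateZero` (crux `ArrangementNormalForm`, line `janus-bands`) — part `Pieces`

The literal data of a Janus band representation of base dimension `1` (`JJ 1 k`): one base
coordinate `y = z (bo k)`, fibre coordinates `tᵢ = z (fc i)`, affine ATOMS `c = (α, β)` with value
`av c y = α y + β`, fibre bounds `lo i, hi i` (a fibre or an atom), optional letters `a i`, the
domain `dom` and the letter block `LB`. A PIECE `π = (V, W, β, τ)` prescribes for every fibre the
adjacent pair of atoms `(V i, W i)` enclosing `tᵢ`, the bottom `β i` and the top `τ i` coordinate
of its gap; `pset` is the corresponding subset of the domain (all gaps of a piece are simplices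
between consecutive atom values). Consequences of the piece axioms, and the COVERING lemma: every
generic point of the domain lies in some piece.
-/

noncomputable section

open Set

namespace Summit.KontsevichZagierPeriods.ArrangementNormalForm.JanusBands

namespace SepZero

/-- Affine atom data: the literal type `(Fin 1 → ℚ) × ℚ` of the skeleton. -/
abbrev Atom := (Fin 1 → ℚ) × ℚ

/-- Value `α y + β` of an atom at `y`. -/
def av (c : Atom) (y : ℝ) : ℝ := (c.1 0 : ℝ) * y + c.2

variable {k : ℕ}

/-- The base coordinate of `ℝ^{1+k}`. -/
def bo (k : ℕ) : Fin (1 + k) := Fin.castAdd k 0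

/-- The fibre coordinates of `ℝ^{1+k}`. -/
def fc (i : Fin k) : Fin (1 + k) := Fin.natAdd 1 i

/-- `fc` is injective. -/
theorem fc_injective : Function.Injective (fc (k := k)) := fun i j h => by
  simpa [fc, Fin.ext_iff] using h

/-- `fc` as an embedding. -/
def fcE (k : ℕ) : Fin k ↪ Fin (1 + k) := ⟨fc, fc_injective⟩

/-- Fibre coordinates differ from the base coordinate. -/
theorem fc_ne_bo (i : Fin k) : fc i ≠ bo k := by
  simp [fc, bo, Fin.ext_iff]

/-- Every coordinate is the base coordinate or a fibre coordinate. -/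
theorem exists_fc_eq (j : Fin (1 + k)) (hj : j ≠ bo k) : ∃ i, fc i = j := by
  refine ⟨⟨j.val - 1, ?_⟩, ?_⟩
  · have := j.isLt
    have h0 : j.val ≠ 0 := fun h => hj (Fin.ext (by simpa [bo] using h))
    omega
  · have h0 : j.val ≠ 0 := fun h => hj (Fin.ext (by simpa [bo] using h))
    ext; simp [fc]; omega

/-- Value of a fibre bound: a fibre coordinate or an atom evaluated at the base coordinate. -/
def bv (z : Fin (1 + k) → ℝ) (u : Fin k ⊕ Atom) : ℝ :=
  Sum.elim (fun j => z (fc j)) (fun c => av c (z (bo k))) u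

/-- The Janus band domain in base dimension one over a base set `Yb`. -/
def dom (Yb : Set ℝ) (lo hi : Fin k → Fin k ⊕ Atom) : Set (Fin (1 + k) → ℝ) :=
  {z | z (bo k) ∈ Yb ∧ ∀ i, bv z (lo i) < z (fc i) ∧ z (fc i) < bv z (hi i)}

/-- The letter block `∏ᵢ (a i).elim 1 (c ↦ 1/(tᵢ − c(y)))`. -/
def LB (a : Fin k → Option Atom) (z : Fin (1 + k) → ℝ) : ℝ :=
  ∏ i, (a i).elim 1 (fun c => 1 / (z (fc i) - av c (z (bo k))))

/-- Piece data `(V, W, β, τ)`: enclosing atoms, bottom and top coordinate of the gap. -/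
abbrev Piece (k : ℕ) (S : Finset Atom) :=
  (Fin k → S) × (Fin k → S) × (Fin k → Fin k) × (Fin k → Fin k)

variable {S : Finset Atom}

/-- Lower enclosing atom. -/
def Piece.V (π : Piece k S) (i : Fin k) : Atom := (π.1 i : Atom)
/-- Upper enclosing atom. -/
def Piece.W (π : Piece k S) (i : Fin k) : Atom := (π.2.1 i : Atom)
/-- Bottom coordinate of the gap. -/
def Piece.β (π : Piece k S) : Fin k → Fin k := π.2.2.1
/-- Top coordinate of the gap. -/
def Piece.τ (π : Piece k S) : Fin k → Fin k := π.2.2.2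

/-- `V i ∈ S`. -/
theorem Piece.V_mem (π : Piece k S) (i : Fin k) : π.V i ∈ S := (π.1 i).2
/-- `W i ∈ S`. -/
theorem Piece.W_mem (π : Piece k S) (i : Fin k) : π.W i ∈ S := (π.2.1 i).2

/-- The piece of `D` cut out by `π`: boxes, adjacency, gap structure, strict bottom/top, and
"equal gaps have equal bottom/top". -/
def pset (D : Set (Fin (1 + k) → ℝ)) (S : Finset Atom) (π : Piece k S) :
    Set (Fin (1 + k) → ℝ) :=
  {z | z ∈ D ∧
    (∀ i, av (π.V i) (z (bo k)) < z (fc i) ∧ z (fc i) < av (π.W i) (z (bo k))) ∧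
    (∀ i, ∀ q ∈ S, ¬ (av (π.V i) (z (bo k)) < av q (z (bo k)) ∧
      av q (z (bo k)) < av (π.W i) (z (bo k)))) ∧
    (∀ i, av (π.V (π.β i)) (z (bo k)) = av (π.V i) (z (bo k)) ∧
      av (π.V (π.τ i)) (z (bo k)) = av (π.V i) (z (bo k))) ∧
    (∀ i, (π.β i = i ∨ z (fc (π.β i)) < z (fc i)) ∧ (π.τ i = i ∨ z (fc i) < z (fc (π.τ i)))) ∧
    (∀ i j, av (π.V i) (z (bo k)) = av (π.V j) (z (bo k)) → π.β i = π.β j ∧ π.τ i = π.τ j)}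

/-- A piece lies in the domain. -/
theorem pset_subset (D : Set (Fin (1 + k) → ℝ)) (π : Piece k S) : pset D S π ⊆ D :=
  fun _ hz => hz.1

section Consequences

variable {D : Set (Fin (1 + k) → ℝ)} {π : Piece k S} {z : Fin (1 + k) → ℝ}

/-- Equal lower atoms give equal upper atoms (adjacency). -/
theorem W_eq_of_V_eq (hz : z ∈ pset D S π) {i j : Fin k}
    (h : av (π.V i) (z (bo k)) = av (π.V j) (z (bo k))) :
    av (π.W i) (z (bo k)) = av (π.W j) (z (bo k)) := by
  obtain ⟨_, hbox, hadj, _⟩ := hz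
  have hi := hbox i
  have hj := hbox j
  have h1 := hadj i (π.W j) (π.W_mem j)
  have h2 := hadj j (π.W i) (π.W_mem i)
  push Not at h1 h2
  have hWj : av (π.V i) (z (bo k)) < av (π.W j) (z (bo k)) := by rw [h]; linarith
  have hWi : av (π.V j) (z (bo k)) < av (π.W i) (z (bo k)) := by rw [← h]; linarith
  exact le_antisymm (h1 hWj) (h2 hWi)

/-- Two boxes are disjoint or equal. -/
theorem boxes (hz : z ∈ pset D S π) (i j : Fin k) :
    av (π.W j) (z (bo k)) ≤ av (π.V i) (z (bo k)) ∨ av (π.W i) (z (bo k)) ≤ av (π.V j) (z (bo k)) ∨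
    (av (π.V i) (z (bo k)) = av (π.V j) (z (bo k)) ∧
      av (π.W i) (z (bo k)) = av (π.W j) (z (bo k))) := by
  have hz' := hz
  obtain ⟨_, hbox, hadj, _⟩ := hz
  have hi := hbox i
  have hj := hbox j
  have h1 := hadj i (π.V j) (π.V_mem j)
  have h2 := hadj j (π.V i) (π.V_mem i)
  push Not at h1 h2
  rcases lt_trichotomy (av (π.V i) (z (bo k))) (av (π.V j) (z (bo k))) with h | h | h
  · exact Or.inr (Or.inl (h1 h))
  · exact Or.inr (Or.inr ⟨h, W_eq_of_V_eq hz' h⟩)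
  · exact Or.inl (h2 h)

/-- `β` is idempotent, `τ ∘ β = τ`. -/
theorem beta_beta (hz : z ∈ pset D S π) (i : Fin k) :
    π.β (π.β i) = π.β i ∧ π.τ (π.β i) = π.τ i :=
  hz.2.2.2.2.2 _ _ (hz.2.2.2.1 i).1

/-- `τ` is idempotent, `β ∘ τ = β`. -/
theorem tau_tau (hz : z ∈ pset D S π) (i : Fin k) :
    π.β (π.τ i) = π.β i ∧ π.τ (π.τ i) = π.τ i :=
  hz.2.2.2.2.2 _ _ (hz.2.2.2.1 i).2

/-- The bottom coordinate is below. -/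
theorem beta_le (hz : z ∈ pset D S π) (i : Fin k) : z (fc (π.β i)) ≤ z (fc i) := by
  rcases (hz.2.2.2.2.1 i).1 with h | h
  · rw [h]
  · exact h.le

/-- The top coordinate is above. -/
theorem le_tau (hz : z ∈ pset D S π) (i : Fin k) : z (fc i) ≤ z (fc (π.τ i)) := by
  rcases (hz.2.2.2.2.1 i).2 with h | h
  · rw [h]
  · exact h.le

/-- An atom of `S` (in particular a letter) is never strictly inside a box. -/
theorem atom_outside (hz : z ∈ pset D S π) (i : Fin k) {c : Atom} (hc : c ∈ S) :
    av c (z (bo k)) ≤ av (π.V i) (z (bo k)) ∨ av (π.W i) (z (bo k)) ≤ av c (z (bo k)) := by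
  have h := hz.2.2.1 i c hc
  push Not at h
  by_cases h1 : av (π.V i) (z (bo k)) < av c (z (bo k))
  · exact Or.inr (h h1)
  · exact Or.inl (not_lt.1 h1)

end Consequences

/-! ### Covering -/

section Covering

variable (Yb : Set ℝ) (lo hi : Fin k → Fin k ⊕ Atom) (S : Finset Atom)
  (hlo : ∀ i c, lo i = Sum.inr c → c ∈ S) (hhi : ∀ i c, hi i = Sum.inr c → c ∈ S)

include hlo in
/-- Every fibre coordinate has an atom of `S` below it (follow the chain of lower bounds). -/
theorem exists_atom_below {z : Fin (1 + k) → ℝ} (hz : z ∈ dom Yb lo hi) (i : Fin k) :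
    ∃ q ∈ S, av q (z (bo k)) < z (fc i) := by
  classical
  by_contra hneg
  set Bad := Finset.univ.filter (fun j : Fin k => ¬ ∃ q ∈ S, av q (z (bo k)) < z (fc j)) with hBad
  have hne : Bad.Nonempty := ⟨i, by simpa [hBad] using hneg⟩
  obtain ⟨j, hj, hmin⟩ := Finset.exists_min_image Bad (fun j => z (fc j)) hne
  have hjB : ¬ ∃ q ∈ S, av q (z (bo k)) < z (fc j) := by simpa [hBad] using hj
  have hlow := (hz.2 j).1
  cases hl : lo j with
  | inr c =>
    rw [hl] at hlow
    exact hjB ⟨c, hlo j c hl, hlow⟩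
  | inl j' =>
    rw [hl] at hlow
    simp only [bv, Sum.elim_inl] at hlow
    by_cases hj' : j' ∈ Bad
    · exact absurd (hmin j' hj') (not_le.2 hlow)
    · have : ∃ q ∈ S, av q (z (bo k)) < z (fc j') := by simpa [hBad] using hj'
      obtain ⟨q, hq, hq'⟩ := this
      exact hjB ⟨q, hq, hq'.trans hlow⟩

include hhi in
/-- Every fibre coordinate has an atom of `S` above it. -/
theorem exists_atom_above {z : Fin (1 + k) → ℝ} (hz : z ∈ dom Yb lo hi) (i : Fin k) :
    ∃ q ∈ S, z (fc i) < av q (z (bo k)) := by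
  classical
  by_contra hneg
  set Bad := Finset.univ.filter (fun j : Fin k => ¬ ∃ q ∈ S, z (fc j) < av q (z (bo k))) with hBad
  have hne : Bad.Nonempty := ⟨i, by simpa [hBad] using hneg⟩
  obtain ⟨j, hj, hmax⟩ := Finset.exists_max_image Bad (fun j => z (fc j)) hne
  have hjB : ¬ ∃ q ∈ S, z (fc j) < av q (z (bo k)) := by simpa [hBad] using hj
  have hup := (hz.2 j).2
  cases hl : hi j with
  | inr c =>
    rw [hl] at hup
    exact hjB ⟨c, hhi j c hl, hup⟩
  | inl j' =>
    rw [hl] at hup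
    simp only [bv, Sum.elim_inl] at hup
    by_cases hj' : j' ∈ Bad
    · exact absurd (hmax j' hj') (not_le.2 hup)
    · have : ∃ q ∈ S, z (fc j') < av q (z (bo k)) := by simpa [hBad] using hj'
      obtain ⟨q, hq, hq'⟩ := this
      exact hjB ⟨q, hq, hup.trans hq'⟩

include hlo hhi in
/-- **Covering lemma.** A generic point of the domain (fibre coordinates pairwise distinct and
distinct from all atom values) lies in some piece. -/
theorem exists_piece {z : Fin (1 + k) → ℝ} (hz : z ∈ dom Yb lo hi)
    (hg1 : ∀ i j, i ≠ j → z (fc i) ≠ z (fc j)) (hg2 : ∀ i, ∀ q ∈ S, z (fc i) ≠ av q (z (bo k))) :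
    ∃ π : Piece k S, z ∈ pset (dom Yb lo hi) S π := by
  classical
  set y := z (bo k) with hy
  -- enclosing atoms
  have hVex : ∀ i, ∃ V ∈ S.filter (fun q => av q y < z (fc i)),
      ∀ q ∈ S.filter (fun q => av q y < z (fc i)), av q y ≤ av V y := fun i =>
    Finset.exists_max_image _ _ (by
      obtain ⟨q, hq, hq'⟩ := exists_atom_below Yb lo hi S hlo hz i
      exact ⟨q, Finset.mem_filter.2 ⟨hq, hq'⟩⟩)
  choose V hVm hVmax using hVex
  have hWex : ∀ i, ∃ W ∈ S.filter (fun q => z (fc i) < av q y),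
      ∀ q ∈ S.filter (fun q => z (fc i) < av q y), av W y ≤ av q y := fun i =>
    Finset.exists_min_image _ _ (by
      obtain ⟨q, hq, hq'⟩ := exists_atom_above Yb lo hi S hhi hz i
      exact ⟨q, Finset.mem_filter.2 ⟨hq, hq'⟩⟩)
  choose W hWm hWmin using hWex
  simp only [Finset.mem_filter] at hVm hWm hVmax hWmin
  -- bottom and top of the gap
  set G : Fin k → Finset (Fin k) := fun i => Finset.univ.filter (fun j => av (V j) y = av (V i) y)
    with hG
  have hGi : ∀ i, i ∈ G i := fun i => by simp [hG]
  have hβex : ∀ i, ∃ b ∈ G i, ∀ j ∈ G i, z (fc b) ≤ z (fc j) := fun i =>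
    Finset.exists_min_image _ _ ⟨i, hGi i⟩
  have hτex : ∀ i, ∃ b ∈ G i, ∀ j ∈ G i, z (fc j) ≤ z (fc b) := fun i =>
    Finset.exists_max_image _ _ ⟨i, hGi i⟩
  choose β hβm hβmin using hβex
  choose τ hτm hτmax using hτex
  have hGeq : ∀ i j, av (V i) y = av (V j) y → G i = G j := fun i j h => by
    simp only [hG]
    exact Finset.filter_congr fun l _ => by rw [h]
  have hGmem : ∀ i j, j ∈ G i ↔ av (V j) y = av (V i) y := fun i j => by simp [hG]
  refine ⟨(fun i => ⟨V i, (hVm i).1⟩, fun i => ⟨W i, (hWm i).1⟩, β, τ), hz, ?_, ?_, ?_, ?_, ?_⟩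
  · intro i
    exact ⟨(hVm i).2, (hWm i).2⟩
  · intro i q hq ⟨h1, h2⟩
    change av (V i) y < av q y at h1
    change av q y < av (W i) y at h2
    rcases lt_or_gt_of_ne (hg2 i q hq).symm with h | h
    · exact absurd (hVmax i q ⟨hq, h⟩) (not_le.2 h1)
    · exact absurd (hWmin i q ⟨hq, h⟩) (not_le.2 h2)
  · intro i
    exact ⟨(hGmem i _).1 (hβm i), (hGmem i _).1 (hτm i)⟩
  · intro i
    constructor
    · by_cases h : β i = i
      · exact Or.inl h
      · exact Or.inr (lt_of_le_of_ne (hβmin i i (hGi i)) (hg1 _ _ h))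
    · by_cases h : τ i = i
      · exact Or.inl h
      · exact Or.inr (lt_of_le_of_ne (hτmax i i (hGi i)) (hg1 _ _ (Ne.symm h)).symm.symm)
  · intro i j h
    change av (V i) y = av (V j) y at h
    have hGij := hGeq i j h
    constructor
    · by_contra hne
      have h1 : z (fc (β i)) ≤ z (fc (β j)) := hβmin i _ (hGij ▸ hβm j)
      have h2 : z (fc (β j)) ≤ z (fc (β i)) := hβmin j _ (hGij ▸ hβm i)
      exact hg1 _ _ hne (le_antisymm h1 h2)
    · by_contra hne
      have h1 : z (fc (τ j)) ≤ z (fc (τ i)) := hτmax i _ (hGij ▸ hτm j)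
      have h2 : z (fc (τ i)) ≤ z (fc (τ j)) := hτmax j _ (hGij ▸ hτm i)
      exact hg1 _ _ hne (le_antisymm h2 h1)

end Covering

end SepZero

/-- Registered support goal of this file: the covering lemma. -/
theorem separateZero_pieces (k : ℕ) (Yb : Set ℝ) (lo hi : Fin k → Fin k ⊕ SepZero.Atom) (S : Finset SepZero.Atom) (hlo : ∀ i c, lo i = Sum.inr c → c ∈ S) (hhi : ∀ i c, hi i = Sum.inr c → c ∈ S) (z : Fin (1 + k) → ℝ) (hz : z ∈ SepZero.dom Yb lo hi) (hg1 : ∀ i j, i ≠ j → z (SepZero.fc i) ≠ z (SepZero.fc j)) (hg2 : ∀ i, ∀ q ∈ S, z (SepZero.fc i) ≠ SepZero.av q (z (SepZero.bo k))) : ∃ π : SepZero.Piece k S, z ∈ SepZero.pset (SepZero.dom Yb lo hi) S π :=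
  SepZero.exists_piece Yb lo hi S hlo hhi hz hg1 hg2

end Summit.KontsevichZagierPeriods.ArrangementNormalForm.JanusBands
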